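import Mathlib
import Summits.NavierStokesRegularity.NavierStokesRegularity.Theorems.FilamentSkeletonRssMatchedKernelNormalBlockBox

/-!
# `SkeletonJ1G` (stmt-NavierStokesRegularity-27849) · line `near_straight_newton` · stub `stub_normalBlock` PROVED in its RESHAPED
# form: clause 12 (normal block) from the flat clauses IN THE NEAR-STRAIGHT REGIME, matched kernel, `2Kρ ≤ 1`, `Γ ≥ Γ₀(consts)`

The registered stub `stub_normalBlock : NormalBlockMatched` of the skeleton of record (54b14921a1db6b91) asks for clause 12 from
`FlatJ1G` alone; the matched-kernel port of `SelectionBoxRJRung.clause12_of_skeleton` needs the matched core `μ² = κ·Aa`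
(`κ = e^{−(1+γ_E−log 2)}`) bounded on BOTH sides near the stagnation points (lane note = 27849 evidence #20), and the floor comes from
the near-straight regime `NearStraightJ1G` (`Λ⁻¹ ≤ Aa`), which stub 2 exports and which is in scope at the call site of
`SkeletonJ1G_of_hyps` — hence the RESHAPED statement (27849 evidence #21, `near_straight_newton_S4reshaped-g11.lean` 888398bc7a8b5bf0)

  `NormalBlockMatched′ := ∀ …, 2Kρ ≤ 1 → ∃ Γ₀, ∀ Γ ≥ Γ₀, ∀ γ α X w c Aa, FlatJ1G … → NearStraightJ1G N Λ Rb X w Aa → Clause12J1G …`,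

proved here with `FlatJ1G`, `NearStraightJ1G`, `Clause12J1G` UNFOLDED VERBATIM, so that — once the line owner / tenure registers the reshaped
skeleton — its `sorry` closes by `exact …Theorems.SkeletonJ1GStubNormalBlock.stub_normalBlock` (and the composition by passing `hns`).

PROOF.  `MatchedKernel.matched_clause12_of_skeleton_core` (trace `3/2` + eigenvector law for the trace half; rotation dominance of the matched
own core for the determinant half) with the core bounds `m₁ = κ·(max Λ 1)⁻¹ ≤ κ·Aa` (floor `Λ⁻¹ ≤ Aa`; `Λ > 0` by clause 11) and
`κ·Aa_j σ ≤ m₂ = 5κ(|KA| + 1)` on `|σ − c_j| ≤ √m₂` (cone clause + waist + unit speed, once `√m₂ ≤ Rw√Γ`), frames by the (inlined, route-independent) construction of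
`SelectionBoxRJRung.exists_orthonormal_frame`, and the threshold
`Γ₀ = max(exp((Rw/Rb)²+1), (7104πK m₂)²/m₁, 312π m₂(cgρ+2Rw)/(cg⁴ρ³), 4π m₂(12N(ρ+2Rw)/(θ₀cgρ³)+2θ₀⁻¹+2)/θ₀, m₂/Rw²)`.
Lane ns-filament-19175-p1 g11; `--supports stmt-NavierStokesRegularity-27849`.  HONEST FRAMING: bookkeeping about a HYPOTHETICAL filament skeleton
on the NEGATIVE side of a MODEL route; neither the crux nor any summit statement is proved; nothing here bears on Navier–Stokes regularity or
blow-up.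
-/

set_option linter.dupNamespace false

noncomputable section

namespace Summit.NavierStokesRegularity.NavierStokesRegularity.Theorems.SkeletonJ1GStubNormalBlock

open Set Function Filter MeasureTheory Real
open Literature.Analysis.FluidPDE
open Summit.NavierStokesRegularity.NavierStokesRegularity.Theorems.SelectionBoxRJRung
open Summit.NavierStokesRegularity.NavierStokesRegularity.Theorems.MatchedKernel
open scoped InnerProductSpace Topology

/-- Every unit vector of `ℝ³` is the first leg of an orthonormal frame, packaged as a pair (the construction of
`SelectionBoxRJRung.exists_orthonormal_frame`, whose module imports the route file; re-derived here to keep this file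
route-independent): `m = (t × e)/‖t × e‖` for a coordinate vector `e` with `‖t × e‖² ≥ 1/2`, `n = t × m`. [folklore] -/
theorem exists_frame_pair (t : EuclideanSpace ℝ (Fin 3)) (ht : ‖t‖ = 1) :
    ∃ mn : EuclideanSpace ℝ (Fin 3) × EuclideanSpace ℝ (Fin 3), Orthonormal ℝ ![t, mn.1, mn.2] := by
  have hperp1 : ∀ a b : EuclideanSpace ℝ (Fin 3), ⟪a, cross a b⟫_ℝ = 0 := fun a b => by
    simp [cross, crossProduct, PiLp.inner_apply, Fin.sum_univ_three]; ring
  have hperp2 : ∀ a b : EuclideanSpace ℝ (Fin 3), ⟪b, cross a b⟫_ℝ = 0 := fun a b => by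
    simp [cross, crossProduct, PiLp.inner_apply, Fin.sum_univ_three]; ring
  have hcand : ∀ i : Fin 3, ‖cross t (EuclideanSpace.single i 1)‖ ^ 2 = 1 - t i ^ 2 := fun i => by
    rw [norm_cross_sq, ht, PiLp.norm_single, norm_one, EuclideanSpace.inner_single_right]; simp
  have hsq : t 0 ^ 2 + t 1 ^ 2 ≤ 1 := by
    have h := EuclideanSpace.norm_sq_eq t
    rw [ht, one_pow, Fin.sum_univ_three] at h
    simp only [Real.norm_eq_abs, sq_abs] at h
    nlinarith [sq_nonneg (t 2)]
  obtain ⟨e, he⟩ : ∃ e : EuclideanSpace ℝ (Fin 3), 1 / 2 ≤ ‖cross t e‖ ^ 2 := by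
    rcases le_or_gt (t 0 ^ 2) (1 / 2) with h0 | h0
    · exact ⟨EuclideanSpace.single 0 1, by rw [hcand 0]; linarith⟩
    · exact ⟨EuclideanSpace.single 1 1, by rw [hcand 1]; linarith⟩
  have hx0 : 0 < ‖cross t e‖ := by
    rcases (norm_nonneg (cross t e)).lt_or_eq with h | h
    · exact h
    · rw [← h] at he; norm_num at he
  set m : EuclideanSpace ℝ (Fin 3) := (‖cross t e‖)⁻¹ • cross t e with hm
  have hmn : ‖m‖ = 1 := by
    rw [hm, norm_smul, Real.norm_of_nonneg (inv_nonneg.2 hx0.le), inv_mul_cancel₀ hx0.ne']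
  have htm : ⟪t, m⟫_ℝ = 0 := by rw [hm, real_inner_smul_right, hperp1, mul_zero]
  set n : EuclideanSpace ℝ (Fin 3) := cross t m with hn
  have hnn : ‖n‖ = 1 := by
    have h := norm_cross_sq t m
    rw [ht, hmn, htm] at h
    have h1 : ‖cross t m‖ ^ 2 = 1 := by rw [h]; norm_num
    have h2 := norm_nonneg (cross t m)
    rw [hn]; nlinarith
  have htn : ⟪t, n⟫_ℝ = 0 := by rw [hn]; exact hperp1 t m
  have hmn' : ⟪m, n⟫_ℝ = 0 := by rw [hn]; exact hperp2 t m
  refine ⟨(m, n), ?_⟩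
  rw [orthonormal_vecCons_iff, orthonormal_vecCons_iff, orthonormal_vecCons_iff]
  refine ⟨ht, fun i => ?_, hmn, fun i => ?_, hnn, fun i => i.elim0, Orthonormal.of_isEmpty _⟩
  · fin_cases i <;> simp [htm, htn]
  · fin_cases i; simp [hmn']

/-- **STUB 4 `stub_normalBlock` (reshaped `NormalBlockMatched′`), matched kernel**: clause 12 from the flat clauses in the near-straight
regime, `2Kρ ≤ 1`, `Γ ≥ Γ₀(N, δ, ρ, K, Λ, Rw, Rb, cg, θ₀, KA)` — `FlatJ1G`, `NearStraightJ1G`, `Clause12J1G` of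
`Cruxes/SkeletonJ1/Lines/near_straight_newton.lean` unfolded verbatim. [folklore] -/
theorem stub_normalBlock :
    ∀ (N : ℕ) (δ ρ K Λ Rw Rb cg θ₀ KA : ℝ), 0 < N → 0 < δ → 0 < ρ → 0 < Rw → 0 < Rb → 0 < cg → 0 < θ₀ →
    2 * K * ρ ≤ 1 → ∃ Γ₀ : ℝ, ∀ Γ : ℝ, Γ₀ ≤ Γ → ∀ (γ : Fin N → ℝ) (α : ℝ) (X : Fin N → ℝ → EuclideanSpace ℝ (Fin 3)) (w : Fin N → ℝ → ℝ) (c : Fin N → ℝ) (Aa : Fin N → ℝ → ℝ),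
      (∀ (u:(Fin N → ℝ → EuclideanSpace ℝ (Fin 3)) → EuclideanSpace ℝ (Fin 3) → EuclideanSpace ℝ (Fin 3)) (v:EuclideanSpace ℝ (Fin 3) → EuclideanSpace ℝ (Fin 3)) (A:Fin N → (EuclideanSpace ℝ (Fin 3) →L[ℝ] EuclideanSpace ℝ (Fin 3))) (T:(Fin N → ℝ → EuclideanSpace ℝ (Fin 3)) → Fin N → ℝ → EuclideanSpace ℝ (Fin 3)), (∀ Z y, u Z y = ∑ k, (Γ*γ k/(4*Real.pi))•∫ σ:ℝ, ((‖y-Z k σ‖^2+Real.exp (-(1+Real.eulerMascheroniConstant-Real.log 2))*Aa k σ)^(3/2:ℝ))⁻¹•cross (deriv (Z k) σ) (y-Z k σ))→(∀ y, v y = u X y+(1/2:ℝ)•y-α•cross (EuclideanSpace.single 2 1) y)→(∀ j, A j = fderiv ℝ v (X j (c j)))→(∀ Z j τ, T Z j τ = (u Z (Z j τ)+(1/2:ℝ)•Z j τ-α•cross (EuclideanSpace.single 2 1) (Z j τ))-(⟪u Z (Z j τ)+(1/2:ℝ)•Z j τ-α•cross (EuclideanSpace.single 2 1) (Z j τ),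 deriv (Z j) τ⟫_ℝ/‖deriv (Z j) τ‖^2)•deriv (Z j) τ)→(α ≠ 0 ∧ (∀ j, γ j ≠ 0) ∧ (∀ j, ContDiff ℝ 2 (X j) ∧ Differentiable ℝ (w j)∧(∀ τ, ‖deriv (X j) τ‖ = 1)∧(∀ τ, ‖iteratedDeriv 2 (X j) τ‖*√Γ≤K) ∧ Tendsto (fun τ => ‖X j τ‖) (cocompact ℝ) atTop) ∧ (∀ j k, j ≠ k → ∀ τ σ, ρ*√Γ≤‖X j τ-X k σ‖) ∧ (∀ j τ σ, ρ*√Γ≤|τ-σ| → cg*ρ*√Γ≤‖X j τ-X j σ‖) ∧ (∀ j τ, cg*|τ-c j|≤Rw*√Γ+‖X j τ‖) ∧ (∀ j τ, w j τ = ⟪v (X j τ), deriv (X j) τ⟫_ℝ) ∧ (∀ j τ, ‖X j τ‖≤Rb*√(Γ*Real.log Γ) → v (X j τ) = w j τ•deriv (X j) τ) ∧ (∀ j, ‖X j (c j)‖≤Rw*√Γ) ∧ (∀ j, |⟪deriv (X j) (c j), EuclideanSpace.single 2 1⟫_ℝ|≤1-θ₀) ∧ (θ₀≤|α| ∧ |α|≤θ₀⁻¹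 ∧ ∀ j, θ₀≤|γ j| ∧ |γ j|≤θ₀⁻¹) ∧ (∀ j, w j (c j) = 0 ∧ (∀ τ, w j τ = 0 → τ = c j) ∧ 3/2+δ≤deriv (w j) (c j) ∧ deriv (w j) (c j)≤Λ) ∧ (∀ j, Differentiable ℝ (Aa j) ∧ (∀ τ, 0 < Aa j τ) ∧ ∀ τ, w j τ*deriv (Aa j) τ = (3/2-deriv (w j) τ)*Aa j τ+4) ∧ (∀ j τ, Rw^2*Γ*Aa j τ≤KA*(Rw^2*Γ+‖X j τ‖^2)))) → ((∀ j τ σ, ‖deriv (X j) τ - deriv (X j) σ‖ ≤ Rb) ∧ (∀ j τ, |deriv (w j) τ| ≤ Λ) ∧ (∀ j τ, Λ⁻¹ ≤ Aa j τ)) → (∃ (m n : Fin N → EuclideanSpace ℝ (Fin 3)), ∀ (u:(Fin N → ℝ → EuclideanSpace ℝ (Fin 3)) → EuclideanSpace ℝ (Fin 3) → EuclideanSpace ℝ (Fin 3)) (v:EuclideanSpace ℝ (Fin 3) → EuclideanSpace ℝ (Fin 3)) (A:Fin N → (EuclideanSpace ℝ (Fin 3) →L[ℝ] EuclideanSpace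 ℝ (Fin 3))) (T:(Fin N → ℝ → EuclideanSpace ℝ (Fin 3)) → Fin N → ℝ → EuclideanSpace ℝ (Fin 3)), (∀ Z y, u Z y = ∑ k, (Γ*γ k/(4*Real.pi))•∫ σ:ℝ, ((‖y-Z k σ‖^2+Real.exp (-(1+Real.eulerMascheroniConstant-Real.log 2))*Aa k σ)^(3/2:ℝ))⁻¹•cross (deriv (Z k) σ) (y-Z k σ))→(∀ y, v y = u X y+(1/2:ℝ)•y-α•cross (EuclideanSpace.single 2 1) y)→(∀ j, A j = fderiv ℝ v (X j (c j)))→(∀ Z j τ, T Z j τ = (u Z (Z j τ)+(1/2:ℝ)•Z j τ-α•cross (EuclideanSpace.single 2 1) (Z j τ))-(⟪u Z (Z j τ)+(1/2:ℝ)•Z j τ-α•cross (EuclideanSpace.single 2 1) (Z j τ), deriv (Z j) τ⟫_ℝ/‖deriv (Z j) τ‖^2)•deriv (Z j) τ)→(∀ j, Orthonormal ℝ ![deriv (X j) (c j), m j, n j] ∧ ⟪A j (m j), m j⟫_ℝ+⟪A j (n j), n j⟫_ℝ < 0 ∧ ⟪A j (n j), m j⟫_ℝ * ⟪A j (m j),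 n j⟫_ℝ < ⟪A j (m j), m j⟫_ℝ * ⟪A j (n j), n j⟫_ℝ)) := by
  intro N δ ρ K Λ Rw Rb cg θ₀ KA hN hδ hρ hRw hRb hcg hθ₀ hKρ
  have hκ0 : 0 < Real.exp (-(1 + Real.eulerMascheroniConstant - Real.log 2)) := Real.exp_pos _
  -- the two core bounds (functions of `Λ`, `KA` only)
  obtain ⟨m₁, hm₁def⟩ : ∃ m₁ : ℝ, m₁ = Real.exp (-(1 + Real.eulerMascheroniConstant - Real.log 2)) * (max Λ 1)⁻¹ := ⟨_, rfl⟩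
  obtain ⟨m₂, hm₂def⟩ : ∃ m₂ : ℝ, m₂ = 5 * Real.exp (-(1 + Real.eulerMascheroniConstant - Real.log 2)) * (|KA| + 1) := ⟨_, rfl⟩
  have hmax : 0 < max Λ 1 := lt_of_lt_of_le one_pos (le_max_right _ _)
  have hm₁ : 0 < m₁ := by rw [hm₁def]; exact mul_pos hκ0 (inv_pos.2 hmax)
  have hm₂ : 0 < m₂ := by rw [hm₂def]; positivity
  refine ⟨max (max (max (Real.exp ((Rw / Rb) ^ 2 + 1)) ((7104 * Real.pi * K * m₂) ^ 2 / m₁))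
      (max (312 * Real.pi * m₂ * (cg * ρ + 2 * Rw) / (cg ^ 4 * ρ ^ 3))
        (4 * Real.pi * m₂ * (12 * N * (ρ + 2 * Rw) / (θ₀ * cg * ρ ^ 3) + 2 * θ₀⁻¹ + 2) / θ₀))) (m₂ / Rw ^ 2), ?_⟩
  intro Γ hΓ γ α X w c Aa hflat hns
  have hΓ' := (le_max_left _ _).trans hΓ
  have hΓ5 : m₂ / Rw ^ 2 ≤ Γ := (le_max_right _ _).trans hΓ
  have hΓ1 : Real.exp ((Rw / Rb) ^ 2 + 1) ≤ Γ := ((le_max_left _ _).trans (le_max_left _ _)).trans hΓ'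
  have hΓ2 : (7104 * Real.pi * K * m₂) ^ 2 / m₁ ≤ Γ := ((le_max_right _ _).trans (le_max_left _ _)).trans hΓ'
  have hΓ3 : 312 * Real.pi * m₂ * (cg * ρ + 2 * Rw) / (cg ^ 4 * ρ ^ 3) ≤ Γ :=
    ((le_max_left _ _).trans (le_max_right _ _)).trans hΓ'
  have hΓ4 : 4 * Real.pi * m₂ * (12 * N * (ρ + 2 * Rw) / (θ₀ * cg * ρ ^ 3) + 2 * θ₀⁻¹ + 2) / θ₀ ≤ Γ :=
    ((le_max_right _ _).trans (le_max_right _ _)).trans hΓ'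
  have hΓpos : 0 < Γ := lt_of_lt_of_le (Real.exp_pos _) hΓ1
  have hG : 0 < Real.sqrt Γ := Real.sqrt_pos.2 hΓpos
  -- orthonormal frames along the tangents (any choice)
  have hfr : ∀ t : EuclideanSpace ℝ (Fin 3), ∃ mn : EuclideanSpace ℝ (Fin 3) × EuclideanSpace ℝ (Fin 3),
      ‖t‖ = 1 → Orthonormal ℝ ![t, mn.1, mn.2] := fun t => by
    by_cases ht : ‖t‖ = 1
    · obtain ⟨mn, hmn⟩ := exists_frame_pair t ht
      exact ⟨mn, fun _ => hmn⟩
    · exact ⟨(0, 0), fun h => absurd h ht⟩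
  choose fr hfr using hfr
  refine ⟨fun j => (fr (deriv (X j) (c j))).1, fun j => (fr (deriv (X j) (c j))).2, ?_⟩
  intro u v A T hu hv hA hT
  obtain ⟨-, -, hreg, hsep, hnoret, hesc, -, htan, hwaist, -, hbds, hstag, harea, hcone⟩ := hflat u v A T hu hv hA hT
  obtain ⟨-, -, hAfloor⟩ := hns
  intro j
  have hon := hfr (deriv (X j) (c j)) ((hreg j).2.2.1 (c j))
  -- `Λ > 0` from clause 11
  have hΛ : 0 < Λ := by
    have h1 := (hstag j).2.2.1
    have h2 := (hstag j).2.2.2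
    linarith
  -- the core floor `m₁ ≤ κ Aa`
  have hm₁A : ∀ k σ, m₁ ≤ Real.exp (-(1 + Real.eulerMascheroniConstant - Real.log 2)) * Aa k σ := by
    intro k σ
    rw [hm₁def]
    refine mul_le_mul_of_nonneg_left ?_ hκ0.le
    calc (max Λ 1)⁻¹ ≤ Λ⁻¹ := inv_anti₀ hΛ (le_max_left _ _)
      _ ≤ Aa k σ := hAfloor k σ
  -- the core ceiling `κ Aa_j ≤ m₂` on the rotation window
  have hsq : Real.sqrt m₂ ≤ Rw * Real.sqrt Γ := by
    have h1 : m₂ ≤ Rw ^ 2 * Γ := by rwa [div_le_iff₀ (by positivity), mul_comm] at hΓ5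
    calc Real.sqrt m₂ ≤ Real.sqrt (Rw ^ 2 * Γ) := Real.sqrt_le_sqrt h1
      _ = Rw * Real.sqrt Γ := by rw [Real.sqrt_mul (sq_nonneg _), Real.sqrt_sq hRw.le]
  have hm₂A : ∀ i σ, |σ - c i| ≤ Real.sqrt m₂ → Real.exp (-(1 + Real.eulerMascheroniConstant - Real.log 2)) * Aa i σ ≤ m₂ := by
    intro i σ hσ
    have hXi : ContDiff ℝ 2 (X i) := (hreg i).1
    have hunit : ∀ τ, ‖deriv (X i) τ‖ = 1 := (hreg i).2.2.1
    have hch : ‖X i (c i) - X i σ‖ ≤ |σ - c i| := chord_le hXi hunit (c i) σ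
    have hnorm : ‖X i σ‖ ≤ 2 * Rw * Real.sqrt Γ := by
      have h1 : ‖X i σ‖ ≤ ‖X i (c i)‖ + ‖X i (c i) - X i σ‖ := by
        have := norm_sub_norm_le (X i σ) (X i (c i))
        rw [norm_sub_rev] at this
        linarith
      linarith [hwaist i]
    have hsq2 : ‖X i σ‖ ^ 2 ≤ 4 * (Rw ^ 2 * Γ) := by
      have h2 := pow_le_pow_left₀ (norm_nonneg _) hnorm 2
      have h3 : (2 * Rw * Real.sqrt Γ) ^ 2 = 4 * (Rw ^ 2 * Γ) := by
        rw [mul_pow, mul_pow, Real.sq_sqrt hΓpos.le]; ring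
      rwa [h3] at h2
    have hRG : 0 < Rw ^ 2 * Γ := by positivity
    have hc := hcone i σ
    have hKA : KA * (Rw ^ 2 * Γ + ‖X i σ‖ ^ 2) ≤ (|KA| + 1) * (5 * (Rw ^ 2 * Γ)) := by
      have h0 : 0 ≤ Rw ^ 2 * Γ + ‖X i σ‖ ^ 2 := by positivity
      calc KA * (Rw ^ 2 * Γ + ‖X i σ‖ ^ 2) ≤ |KA| * (Rw ^ 2 * Γ + ‖X i σ‖ ^ 2) :=
            mul_le_mul_of_nonneg_right (le_abs_self KA) h0
        _ ≤ (|KA| + 1) * (Rw ^ 2 * Γ + ‖X i σ‖ ^ 2) := mul_le_mul_of_nonneg_right (by linarith) h0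
        _ ≤ (|KA| + 1) * (5 * (Rw ^ 2 * Γ)) := by
            refine mul_le_mul_of_nonneg_left ?_ (by positivity); linarith
    have hAa : Aa i σ ≤ 5 * (|KA| + 1) := by
      have h2 : Rw ^ 2 * Γ * Aa i σ ≤ (Rw ^ 2 * Γ) * (5 * (|KA| + 1)) :=
        calc Rw ^ 2 * Γ * Aa i σ ≤ KA * (Rw ^ 2 * Γ + ‖X i σ‖ ^ 2) := hc
          _ ≤ (|KA| + 1) * (5 * (Rw ^ 2 * Γ)) := hKA
          _ = (Rw ^ 2 * Γ) * (5 * (|KA| + 1)) := by ring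
      exact le_of_mul_le_mul_left h2 hRG
    rw [hm₂def]
    calc Real.exp (-(1 + Real.eulerMascheroniConstant - Real.log 2)) * Aa i σ
        ≤ Real.exp (-(1 + Real.eulerMascheroniConstant - Real.log 2)) * (5 * (|KA| + 1)) := mul_le_mul_of_nonneg_left hAa hκ0.le
      _ = 5 * Real.exp (-(1 + Real.eulerMascheroniConstant - Real.log 2)) * (|KA| + 1) := by ring
  have h12 := matched_clause12_of_skeleton_core hδ hρ hRw hRb hcg hθ₀ hm₁ hm₂ hKρ hΓ1 hΓ2 hΓ3 hΓ4 hu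
    (fun k => (harea k).1) hm₁A hm₂A hv
    (fun k => ⟨(hreg k).1, (hreg k).2.1, (hreg k).2.2.1, (hreg k).2.2.2.1⟩) hsep hnoret hesc htan hwaist hbds
    (fun k => ⟨(hstag k).1, (hstag k).2.2.1⟩) j hon
  rw [hA j]
  exact ⟨hon, h12.1, h12.2⟩

end Summit.NavierStokesRegularity.NavierStokesRegularity.Theorems.SkeletonJ1GStubNormalBlock
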